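import Summits.BirchSwinnertonDyer.BirchSwinnertonDyer.Theorems.ManinLocalTwoThreeCDivisionNeronPeriodsConsumers
import Summits.BirchSwinnertonDyer.BirchSwinnertonDyer.Theorems.ManinLocalTwoThreeCDivisionGamma1Transfer
import Summits.BirchSwinnertonDyer.BirchSwinnertonDyer.Theorems.ManinLocalTwoThreeCDivisionGamma1Stevens
import Summits.BirchSwinnertonDyer.BirchSwinnertonDyer.Theorems.ManinLocalTwoThreeUnboundedDenominatorsWeightOfCDT
import HarnessLib

/-!
# The `c`-division chain from the Unbounded Denominators THEOREM 1 VERBATIM (rational-integer coefficients), not from Remarks 58–59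
(route `ManinLocalTwoThree`, cruxes C3 `ManinPrimeToThreeAtNine` stmt-BirchSwinnertonDyer-22968 / C2 `ManinOddAtFour` stmt-BirchSwinnertonDyer-22967 /
residual C5 stmt-BirchSwinnertonDyer-22969; cell bsd-f2-manin, prover p2 gen 21; `--supports stmt-BirchSwinnertonDyer-22968`)

WHAT CHANGES.  Every landed composition of the `c`-division line (p3 `CDivAssembly.maninPrimeToThreeAtNine_of_CDT`, LEAD
`CDivisionUDC.periodLatticeGamma1_le_neron_of_CDT` / `…maninPrimeToAdditiveFiveLe_of_CDT` / `…maninOddAtFour_of_CDT_of_indexNeFourOddSquarefree`,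
p2 g20 `CDivision.abs_maninConstant₁_eq_one_of_CDT`, -an g45 `CDivisionNeron.*_of_CDT_cDivisionWitnessLaw*`) takes as hypothesis the vendored
ALGEBRAIC-INTEGER fact `Literature.NumberTheory.Automorphic.CalegariDimitrovTang2025_unboundedDenominators_algInt` = Calegari–Dimitrov–Tang's Remark 58
(«our proof generalizes in the obvious way …») / Remark 59 (Voight's trace argument), because the consumed rendering was `UnboundedDenominatorsWeightAlgInt k`.
But the witness `F = 12·℘_{Λ_W}(ℰ_f)·G·Δ^a` HAS RATIONAL-INTEGER `q`-coefficients: (QEXNB) `IntegralQSeries.integralQSeriesNearCuspB_holds` returns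
`b : ℕ → ℤ` (Honda at the multiplier `1`, integer presentation form `G`, `Δ^a ∈ ℤ⟦q⟧`), and `CDivAssembly.exists_cDivisionWitness` merely casts it to `ℂ`
and weakens to `IsIntegral ℤ`.  With p2 g17's `UDWOfCDT.unboundedDenominatorsWeight_of_CDT : CalegariDimitrovTang2025_unboundedDenominators →
∀ k, UnboundedDenominatorsWeight k` (the INTEGER rendering, landed) the whole chain therefore runs from the vendored
`CalegariDimitrovTang2025_unboundedDenominators` = **Theorem 1 of the paper as printed** (`f ∈ ℤ⟦q^{1/N}⟧`, holomorphic-at-the-cusps special case).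
Since `CalegariDimitrovTang2025_unboundedDenominators_of_algInt : …_algInt → …` (Literature), every theorem below is STRONGER than its `_algInt`
twin (§5 records the implication), and the trusted printed input of C3 / C5 / Stevens-`|c₁| = 1` / C2-mod-E-an-152c shrinks from «Theorem 1 + Remarks
58–59» to «Theorem 1».

* §1 `periodLatticeGamma1_le_of_latticeWitness_of_UDWInt` — LEAD's lattice-witness glue with `UnboundedDenominatorsWeight k` and an INTEGER `q`-series
  (same proof: UDW ⟹ `Γ(MN) ≤ Stab`, `Γ₁`-Wohlfahrt `DivisionGamma1.gamma1_le_of_Gamma_le_of_forall_trace_two_mem` ⟹ `Γ₁(N) ≤ Stab` ⟹ `Λ₁(f) ⊆ Λ`);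
  `X₀` / `X₁` specialisations.
* §2 `exists_cDivisionWitnessInt` — p3's assembly re-run keeping `b : ℕ → ℤ`; `cDivisionWitnessInt₁_of_datum` (LEAD's transfer to an `X₁(N)`-datum).
* §3 `periodLatticeGamma1_le_neron_of_CDTInt : CalegariDimitrovTang2025_unboundedDenominators → ∀ X₀(N)-datum, Λ₁(f) ⊆ Λ_W` (an's E-an-250 / Stevens I
  strong, by name `gamma1PeriodsInNeronLattice_of_CDTInt`), and Stevens' `|c₁| = 1` for optimal `X₁(N)`-data (`abs_maninConstant₁_eq_one_of_CDTInt`).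
* §4 route compositions from Theorem 1: `|c₀| = 1` at odd `p² ∣ N`, **C3** `maninPrimeToThreeAtNine_of_CDTInt`, **C5** `maninPrimeToAdditiveFiveLe_of_CDTInt`,
  `c₀ ∣ 2` at `4 ∣ N`, **C2 ⟸ Thm 1 ∧ E-an-152c** `maninOddAtFour_of_CDTInt_of_indexNeFourOddSquarefree` (and the Frey-habitat form), `ManinConstantOne ⟸
  PrintedSemistableManinFacts ∧ Thm 1 ∧ E-an-152c` through the route's `closes`.
* §5 the `_algInt` hypothesis implies the integer one (`periodLatticeGamma1_le_neron_of_CDTAlgInt'`), so nothing landed is weakened.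

HONEST FRAMING.  CONDITIONAL results: `CalegariDimitrovTang2025_unboundedDenominators` is a PRINTED theorem (J. Amer. Math. Soc. 38 (2025), Thm. 1),
statement-only in the tree (`def … : Prop`); E-an-152c `CDivisionNeron.ShimuraIndexNeFourAtFourOddSquarefree` is OPEN.  C2/C3/C5 as filed, Stevens'
conjecture, Manin's conjecture and BSD are NOT proved here.  No definitions, no named facts, no sorry.
[cite: CalegariDimitrovTang2025, Thm. 1.0.1 (= arXiv Thm. 1; Remarks 58–59 NOT used)] [cite: Wohlfahrt1964, Thm. 2] [cite: KurthLong2008, Prop. 18]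
[cite: Honda1970, Thm. 9] [cite: Manin1972, Prop. 1.4, Thm. 1.6] [cite: Stevens1989, §2] [cite: LingOesterle1991, Thm. 6]
-/

set_option autoImplicit false
-- lint-debt: the directory name repeats the summit name (sibling precedent `ManinLocalTwoThreeCDivisionAssembly.lean`)
set_option linter.dupNamespace false

noncomputable section

open scoped MatrixGroups ModularForm PeriodPair Manifold Topology
open CongruenceSubgroup Complex Filter PowerSeries
open UpperHalfPlane hiding I
open WeierstrassCurve Literature.NumberTheory.EllipticCurves Literature.NumberTheory.EllipticCurves.ModularForms
open Literature.NumberTheory.Automorphic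
open Summit.BirchSwinnertonDyer.Rank1Residual.ManinAdditive
open Summit.BirchSwinnertonDyer.Rank1Residual.ManinAdditive.UDCKummerLine
open Summit.BirchSwinnertonDyer.Rank1Residual.ManinAdditive.ShimuraKernel

namespace Summit.BirchSwinnertonDyer.BirchSwinnertonDyer.Theorems.ManinLocalTwoThree.CDivisionInt

variable {W : WeierstrassCurve ℚ} [W.IsElliptic] [W.IsGloballyMinimal] {N : ℕ} [NeZero N]

/-! ## §1 Lattice witness with INTEGER `q`-series ∧ `UnboundedDenominatorsWeight k` ⟹ `Λ₁(f) ⊆ Λ` -/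

omit [NeZero N] in
/-- **A lattice witness with rational-integer `q`-expansion forces `Λ₁(f) ⊆ Λ`** — LEAD's `CDivisionUDC.periodLatticeGamma1_le_of_latticeWitness_of_UDW`
with the INTEGER rendering `UnboundedDenominatorsWeight k` of Unbounded Denominators: if `e·Λ₀(f) ⊆ Λ` (`e ≠ 0`) and a holomorphic weight-`k` `F` has
`Γ₀(N)`-stabiliser EXACTLY `{γ : {∞,γ∞}_f ∈ Λ}`, exponential growth at every cusp and an integer `q`-series on `ℍ`, then the stabiliser contains `Γ(MN)`,
hence (`Γ₁`-Wohlfahrt) `Γ₁(N)`, so every `Γ₁(N)`-period of `f` lies in `Λ`. [cite: CalegariDimitrovTang2025, Thm. 1.0.1] [cite: Wohlfahrt1964, Thm. 2] -/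
theorem periodLatticeGamma1_le_of_latticeWitness_of_UDWInt [NeZero N] (f : CuspForm (Gamma0 N) 2) (Λ : PeriodPair) {e : ℤ}
    (he : e ≠ 0) (hcomm : ∀ w ∈ periodLattice f, (e : ℂ) * w ∈ Λ.lattice) {k : ℤ} (hUDW : UnboundedDenominatorsWeight k)
    {F : ℍ → ℂ} (hhol : MDifferentiable 𝓘(ℂ) 𝓘(ℂ) F)
    (hinv : ∀ γ : Gamma0 N, cuspSymbol f γ ∈ Λ.lattice → F ∣[k] (γ : SL(2, ℤ)) = F)
    (hstab : ∀ γ : Gamma0 N, F ∣[k] (γ : SL(2, ℤ)) = F → cuspSymbol f γ ∈ Λ.lattice)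
    (hgrowth : ∀ g : SL(2, ℤ), ∃ C A r : ℝ, ∀ τ : ℍ, A ≤ τ.im → ‖(F ∣[k] g) τ‖ ≤ C * Real.exp (r * τ.im))
    (hq : ∃ b : ℕ → ℤ, ∀ τ : ℍ, HasSum (fun n : ℕ ↦ (b n : ℂ) * Complex.exp (2 * Real.pi * Complex.I * (τ : ℂ) * n)) (F τ)) :
    ∀ z ∈ periodLatticeGamma1 f, z ∈ Λ.lattice := by
  obtain ⟨Γ, hmem, hle, hfi, htr⟩ := CDivisionUDC.exists_latticeStabilizerSubgroup f Λ he hcomm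
  have hN : 0 < N := Nat.pos_of_ne_zero (NeZero.ne N)
  have hΓinv : ∀ γ ∈ Γ, F ∣[k] γ = F := fun γ hγ ↦ hinv ⟨γ, hle hγ⟩ ((hmem ⟨γ, hle hγ⟩).mp hγ)
  obtain ⟨M, hM, hcong⟩ := hUDW Γ hfi F hhol hΓinv hgrowth hq
  have hΓMN : CongruenceSubgroup.Gamma (M * N) ≤ Γ := by
    intro g hg
    have hgN : g ∈ CongruenceSubgroup.Gamma N := Gamma_mul_le_right M N hg
    have hgM : g ∈ CongruenceSubgroup.Gamma M := Gamma_mul_le_left M N hg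
    have hg0 : g ∈ Gamma0 N := Gamma_le_Gamma0 N hgN
    exact (hmem ⟨g, hg0⟩).mpr (hstab ⟨g, hg0⟩ (hcong g hgM))
  have h1 : Gamma1 N ≤ Γ :=
    DivisionGamma1.gamma1_le_of_Gamma_le_of_forall_trace_two_mem N Γ
      (fun γ hγ h2 ↦ htr γ (Gamma1_in_Gamma0 N hγ) (Or.inl h2)) (Nat.mul_pos hM hN) hΓMN
  intro z hz
  induction hz using AddSubgroup.closure_induction with
  | mem x hx =>
    obtain ⟨γ, rfl⟩ := hx
    exact (hmem _).mp (h1 γ.2)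
  | zero => exact zero_mem _
  | add x y _ _ hx hy => exact add_mem hx hy
  | neg x _ hx => exact neg_mem hx

omit [W.IsElliptic] [W.IsGloballyMinimal] in
/-- **`c`-division witness with integer `q`-series ∧ `UnboundedDenominatorsWeight k` ⟹ `Λ₁(f) ⊆ Λ_W`** for any `X₀(N)`-datum (`e = c`).
[cite: CalegariDimitrovTang2025, Thm. 1.0.1] [cite: Wohlfahrt1964, Thm. 2] -/
theorem periodLatticeGamma1_le_neron_of_cDivisionWitness_of_UDWInt (D : ModularParametrizationData W N) {k : ℤ}
    (hUDW : UnboundedDenominatorsWeight k) {F : ℍ → ℂ} (hhol : MDifferentiable 𝓘(ℂ) 𝓘(ℂ) F)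
    (hinv : ∀ γ : Gamma0 N, cuspSymbol D.f γ ∈ D.L.lattice → F ∣[k] (γ : SL(2, ℤ)) = F)
    (hstab : ∀ γ : Gamma0 N, F ∣[k] (γ : SL(2, ℤ)) = F → cuspSymbol D.f γ ∈ D.L.lattice)
    (hgrowth : ∀ g : SL(2, ℤ), ∃ C A r : ℝ, ∀ τ : ℍ, A ≤ τ.im → ‖(F ∣[k] g) τ‖ ≤ C * Real.exp (r * τ.im))
    (hq : ∃ b : ℕ → ℤ, ∀ τ : ℍ, HasSum (fun n : ℕ ↦ (b n : ℂ) * Complex.exp (2 * Real.pi * Complex.I * (τ : ℂ) * n)) (F τ)) :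
    ∀ z ∈ periodLatticeGamma1 D.f, z ∈ D.L.lattice :=
  periodLatticeGamma1_le_of_latticeWitness_of_UDWInt D.f D.L D.maninConstant_ne_zero_holds D.smul_periodLattice_le hUDW hhol hinv hstab
    hgrowth hq

omit [W.IsElliptic] [W.IsGloballyMinimal] in
/-- **`c₁`-division witness with integer `q`-series ∧ `UnboundedDenominatorsWeight k` ⟹ `Λ₁(f) ⊆ Λ_{W}`** for any `X₁(N)`-datum (`e = c₁·φ(N)`,
`CDivisionUDC.totient_smul_periodLattice_le`). [cite: CalegariDimitrovTang2025, Thm. 1.0.1] [cite: Wohlfahrt1964, Thm. 2] [cite: LingOesterle1991, Thm. 6] -/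
theorem periodLatticeGamma1_le_neron₁_of_cDivisionWitness_of_UDWInt (D : Gamma1ParametrizationData W N) {k : ℤ}
    (hUDW : UnboundedDenominatorsWeight k) {F : ℍ → ℂ} (hhol : MDifferentiable 𝓘(ℂ) 𝓘(ℂ) F)
    (hinv : ∀ γ : Gamma0 N, cuspSymbol D.f γ ∈ D.L.lattice → F ∣[k] (γ : SL(2, ℤ)) = F)
    (hstab : ∀ γ : Gamma0 N, F ∣[k] (γ : SL(2, ℤ)) = F → cuspSymbol D.f γ ∈ D.L.lattice)
    (hgrowth : ∀ g : SL(2, ℤ), ∃ C A r : ℝ, ∀ τ : ℍ, A ≤ τ.im → ‖(F ∣[k] g) τ‖ ≤ C * Real.exp (r * τ.im))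
    (hq : ∃ b : ℕ → ℤ, ∀ τ : ℍ, HasSum (fun n : ℕ ↦ (b n : ℂ) * Complex.exp (2 * Real.pi * Complex.I * (τ : ℂ) * n)) (F τ)) :
    ∀ z ∈ periodLatticeGamma1 D.f, z ∈ D.L.lattice := by
  have hN : (Nat.totient N : ℤ) ≠ 0 := by exact_mod_cast (Nat.totient_pos.mpr (Nat.pos_of_ne_zero (NeZero.ne N))).ne'
  exact periodLatticeGamma1_le_of_latticeWitness_of_UDWInt D.f D.L (mul_ne_zero D.maninConstant_ne_zero hN)
    (CDivisionUDC.totient_smul_periodLattice_le D) hUDW hhol hinv hstab hgrowth hq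

/-! ## §2 The `c`-division witness has a RATIONAL-INTEGER `q`-series (p3's assembly, keeping `b : ℕ → ℤ`) -/

/-- **The `c`-division witness with INTEGER `q`-expansion.**  For every `X₀(N)`-datum `D` of a globally minimal `W`: a weight `k` and a holomorphic
`F : ℍ → ℂ` (`= 12·℘_{Λ_W}(ℰ_f)·G·Δ^a`) with `Γ₀(N)`-stabiliser EXACTLY `Γ^{(c)} = {γ : {∞,γ∞}_f ∈ Λ_W}`, exponential growth at every cusp, and a `q`-series
`Σ bₙ e^{2πinτ}`, `bₙ ∈ ℤ`, summing to `F` on all of `ℍ` — VERBATIM p3's `CDivAssembly.exists_cDivisionWitness` except that the integer coefficients delivered by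
(QEXNB) `IntegralQSeries.integralQSeriesNearCuspB_holds` are NOT cast away. [cite: Honda1970, Thm. 9] [cite: ShimuraIATAF1971, §2.4, Thm. 3.52, Thm. 7.14]
[cite: Manin1972, Prop. 1.4] -/
theorem exists_cDivisionWitnessInt (W : WeierstrassCurve ℚ) [W.IsElliptic] [W.IsGloballyMinimal] {N : ℕ} [NeZero N]
    (D : ModularParametrizationData W N) :
    ∃ (k : ℤ) (F : ℍ → ℂ), MDifferentiable 𝓘(ℂ) 𝓘(ℂ) F ∧
      (∀ γ : Gamma0 N, cuspSymbol D.f γ ∈ D.L.lattice → F ∣[k] (γ : SL(2, ℤ)) = F) ∧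
      (∀ γ : Gamma0 N, F ∣[k] (γ : SL(2, ℤ)) = F → cuspSymbol D.f γ ∈ D.L.lattice) ∧
      (∀ g : SL(2, ℤ), ∃ C A m : ℝ, ∀ τ : ℍ, A ≤ τ.im → ‖(F ∣[k] g) τ‖ ≤ C * Real.exp (m * τ.im)) ∧
      (∃ b : ℕ → ℤ, ∀ τ : ℍ, HasSum (fun n : ℕ ↦ (b n : ℂ) * Complex.exp (2 * Real.pi * Complex.I * (τ : ℂ) * n)) (F τ)) := by
  classical
  have hf : D.f ≠ 0 := D.isNewformOf.1.ne_zero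
  have hc : (D.c : ℂ) ≠ 0 := D.cast_c_ne_zero
  -- the cover group and the exponent
  obtain ⟨Γ, hmem, hle, hfi, -, -⟩ := CDivision.exists_cDivisionCoverSubgroup D
  obtain ⟨a, ha2, hgr⟩ := CDivGrowth.cDivGrowth_uniform W D Γ hle hfi
  -- the core: presentation, extension, exact stabiliser
  obtain ⟨k, G, F, _hk, _hG0, hGint, hFhol, hFeq, hstab⟩ := CDivision.exists_cDivisionWitnessCore D hc a
  have hinv : ∀ γ : Gamma0 N, cuspSymbol D.f γ ∈ D.L.lattice → F ∣[k + 12 * (a : ℤ)] (γ : SL(2, ℤ)) = F :=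
    fun γ h ↦ (hstab γ).mp h
  have hstab' : ∀ γ : Gamma0 N, F ∣[k + 12 * (a : ℤ)] (γ : SL(2, ℤ)) = F → cuspSymbol D.f γ ∈ D.L.lattice :=
    fun γ h ↦ (hstab γ).mpr h
  -- growth
  have hFeq' : ∀ τ : ℍ, eichlerIntegral D.f τ ∉ D.L.lattice →
      F τ = ℘[D.L] (eichlerIntegral D.f τ) * ((12 : ℂ) * (G : ModularForm (Gamma0 N) k) τ * ModularForm.discriminant τ ^ a) := by
    intro τ hτ
    rw [← hFeq τ hτ]
    change _ = ℘[D.L] (eichlerIntegral D.f τ) * ((12 : ℂ) * G τ * ModularForm.discriminant τ ^ a)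
    ring
  have hgrowth := hgr k (G : ModularForm (Gamma0 N) k) F (fun γ hγ ↦ hinv ⟨γ, hle hγ⟩ ((hmem ⟨γ, hle hγ⟩).mp hγ)) hFeq'
  -- integer `q`-series near `i∞`, then on `ℍ`
  obtain ⟨g, B, hgden, hΦ⟩ := CDivCuspGerm.cDivCuspSeries W D a ha2
  choose bd hbd using hGint
  have hGsum : ∀ τ : ℍ, HasSum (fun n : ℕ ↦ (bd n : ℂ) * Complex.exp (2 * Real.pi * Complex.I * (τ : ℂ) * n)) (G τ) :=
    CDivAssembly.hasSum_int_of_cuspCoeff G bd hbd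
  obtain ⟨T, hT⟩ := exists_forall_eichlerIntegral_smul_notMem D.f hf D.L 1
  obtain ⟨b, B', hbB'⟩ := IntegralQSeries.integralQSeriesNearCuspB_holds
    (fun τ ↦ (12 : ℂ) * ℘[D.L] (eichlerIntegral D.f τ) * ModularForm.discriminant τ ^ a) F (fun τ ↦ G τ) g bd hgden ⟨B, hΦ⟩ hGsum
    ⟨T, fun τ hτ ↦ by rw [← hFeq τ (by simpa using hT τ hτ.le)]; ring⟩
  exact ⟨k + 12 * (a : ℤ), F, hFhol, hinv, hstab', hgrowth, b,
    IntegralQSeries.qExpansionExtensionPrinciple_holds F hFhol (fun n ↦ (b n : ℂ)) B' hbB'⟩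

omit [W.IsElliptic] [W.IsGloballyMinimal] in
/-- **Transfer to an `X₁(N)`-datum of the same curve** (LEAD's `CDivisionUDC.cDivisionWitness₁_of_datum`, integer form): an `X₁(N)`-datum `D₁` and an
`X₀(N)`-datum `D` of the same `W` at the same level share the newform (`CDivisionUDC.f_eq_gamma1`) and the Néron lattice (`CDivisionUDC.lattice_eq_gamma1`), so the
integer witness of `D` is a witness for `D₁`. [folklore] -/
theorem cDivisionWitnessInt₁_of_datum (D₁ : Gamma1ParametrizationData W N) (D : ModularParametrizationData W N)
    (hW : ∃ (k : ℤ) (F : ℍ → ℂ), MDifferentiable 𝓘(ℂ) 𝓘(ℂ) F ∧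
        (∀ γ : Gamma0 N, cuspSymbol D.f γ ∈ D.L.lattice → F ∣[k] (γ : SL(2, ℤ)) = F) ∧
        (∀ γ : Gamma0 N, F ∣[k] (γ : SL(2, ℤ)) = F → cuspSymbol D.f γ ∈ D.L.lattice) ∧
        (∀ g : SL(2, ℤ), ∃ C A m : ℝ, ∀ τ : ℍ, A ≤ τ.im → ‖(F ∣[k] g) τ‖ ≤ C * Real.exp (m * τ.im)) ∧
        (∃ b : ℕ → ℤ, ∀ τ : ℍ, HasSum (fun n : ℕ ↦ (b n : ℂ) * Complex.exp (2 * Real.pi * Complex.I * (τ : ℂ) * n)) (F τ))) :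
    ∃ (k : ℤ) (F : ℍ → ℂ), MDifferentiable 𝓘(ℂ) 𝓘(ℂ) F ∧
        (∀ γ : Gamma0 N, cuspSymbol D₁.f γ ∈ D₁.L.lattice → F ∣[k] (γ : SL(2, ℤ)) = F) ∧
        (∀ γ : Gamma0 N, F ∣[k] (γ : SL(2, ℤ)) = F → cuspSymbol D₁.f γ ∈ D₁.L.lattice) ∧
        (∀ g : SL(2, ℤ), ∃ C A m : ℝ, ∀ τ : ℍ, A ≤ τ.im → ‖(F ∣[k] g) τ‖ ≤ C * Real.exp (m * τ.im)) ∧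
        (∃ b : ℕ → ℤ, ∀ τ : ℍ, HasSum (fun n : ℕ ↦ (b n : ℂ) * Complex.exp (2 * Real.pi * Complex.I * (τ : ℂ) * n)) (F τ)) := by
  have hf := CDivisionUDC.f_eq_gamma1 D D₁
  have hΛ := CDivisionUDC.lattice_eq_gamma1 D D₁
  obtain ⟨k, F, hhol, hinv, hstab, hgr, hq⟩ := hW
  refine ⟨k, F, hhol, fun γ hγ ↦ hinv γ (by rw [hf, hΛ]; exact hγ), fun γ hγ ↦ ?_, hgr, hq⟩
  rw [← hf, ← hΛ]; exact hstab γ hγ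

/-! ## §3 From THEOREM 1 (`CalegariDimitrovTang2025_unboundedDenominators`, `ℤ`-coefficients): `Λ₁(f) ⊆ Λ_W` and Stevens' `|c₁| = 1` -/

omit [W.IsElliptic] [W.IsGloballyMinimal] in
/-- **`Λ₁(f) ⊆ Λ_W` for EVERY `X₀(N)`-datum of a globally minimal curve, modulo CDT THEOREM 1** (rational-integer coefficients; = an g45's E-an-250
`Gamma1PeriodsInNeronLattice`, «Stevens' Conjecture I, strong form», def-free) — the integer `c`-division witness (§2) + p2 g17's
`UDWOfCDT.unboundedDenominatorsWeight_of_CDT` + the `Γ₁`-Wohlfahrt kernel (§1).  Strictly stronger than LEAD's `CDivisionUDC.periodLatticeGamma1_le_neron_of_CDT`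
(hypothesis `_algInt` ⟹ this hypothesis, §5).  CONDITIONAL on the printed theorem; Stevens' conjecture is not proved by this.
[cite: CalegariDimitrovTang2025, Thm. 1.0.1] [cite: Wohlfahrt1964, Thm. 2] [cite: Stevens1989, §2] -/
theorem periodLatticeGamma1_le_neron_of_CDTInt [W.IsElliptic] [W.IsGloballyMinimal]
    (hCDT : CalegariDimitrovTang2025_unboundedDenominators) (D : ModularParametrizationData W N) :
    ∀ z ∈ periodLatticeGamma1 D.f, z ∈ D.L.lattice := by
  obtain ⟨k, F, hhol, hinv, hstab, hgrowth, hq⟩ := exists_cDivisionWitnessInt W D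
  exact periodLatticeGamma1_le_neron_of_cDivisionWitness_of_UDWInt D (UDWOfCDT.unboundedDenominatorsWeight_of_CDT hCDT k)
    hhol hinv hstab hgrowth hq

/-- **an g45's row E-an-250 `CDivisionNeron.Gamma1PeriodsInNeronLattice` BY NAME ⟸ CDT Theorem 1.**  CONDITIONAL on the printed theorem.
[cite: CalegariDimitrovTang2025, Thm. 1.0.1] [cite: Stevens1989, §2] -/
theorem gamma1PeriodsInNeronLattice_of_CDTInt (hCDT : CalegariDimitrovTang2025_unboundedDenominators) :
    CDivisionNeron.Gamma1PeriodsInNeronLattice :=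
  fun _ _ _ _ _ D γ ↦ periodLatticeGamma1_le_neron_of_CDTInt hCDT D _ (cuspSymbol_mem_periodLatticeGamma1 D.f γ)

omit [W.IsElliptic] [W.IsGloballyMinimal] in
/-- **`Λ₁(f) ⊆ Λ_W` for every `X₁(N)`-datum of a globally minimal curve, modulo CDT Theorem 1** (an's E-an-252 shape): the `X₀(N)`-datum of the same curve
(`CDivision.nonempty_modularParametrizationData_of_gamma1`) carries the integer witness, which transfers (§2). [cite: CalegariDimitrovTang2025, Thm. 1.0.1]
[cite: Stevens1989, §2] -/
theorem periodLatticeGamma1_le_neron₁_of_CDTInt [W.IsElliptic] [W.IsGloballyMinimal]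
    (hCDT : CalegariDimitrovTang2025_unboundedDenominators) (D₁ : Gamma1ParametrizationData W N) :
    ∀ z ∈ periodLatticeGamma1 D₁.f, z ∈ D₁.L.lattice := by
  obtain ⟨D⟩ := CDivision.nonempty_modularParametrizationData_of_gamma1 D₁
  obtain ⟨k, F, hhol, hinv, hstab, hgrowth, hq⟩ := cDivisionWitnessInt₁_of_datum D₁ D (exists_cDivisionWitnessInt W D)
  exact periodLatticeGamma1_le_neron₁_of_cDivisionWitness_of_UDWInt D₁ (UDWOfCDT.unboundedDenominatorsWeight_of_CDT hCDT k)
    hhol hinv hstab hgrowth hq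

/-- **Stevens' `|c₁| = 1` modulo CDT THEOREM 1** — for EVERY optimal `X₁(N)`-datum `D₁` (`Λ_W = c₁·Λ₁(f)`) of a globally minimal `W`, at every level:
`Λ₁(f) ⊆ Λ_W = c₁Λ₁(f)` is absurd for `|c₁| ≥ 2` (`DivisionGamma1.not_forall_gamma1_division_of_isOptimal`).  Strictly stronger than p2 g20's
`CDivision.abs_maninConstant₁_eq_one_of_CDT` (hypothesis `_algInt`).  CONDITIONAL on the printed theorem; Stevens' conjecture, Manin's conjecture and BSD are
not proved by this. [cite: Stevens1989, §2 (Conjecture: `c = ±1`)] [cite: CalegariDimitrovTang2025, Thm. 1.0.1] -/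
theorem abs_maninConstant₁_eq_one_of_CDTInt (hCDT : CalegariDimitrovTang2025_unboundedDenominators)
    {W : WeierstrassCurve ℚ} [W.IsElliptic] [W.IsGloballyMinimal] {N : ℕ} [NeZero N]
    (D₁ : Gamma1ParametrizationData W N) (hopt : D₁.IsOptimal) : |D₁.maninConstant| = 1 := by
  have hc0 : D₁.maninConstant ≠ 0 := D₁.maninConstant_ne_zero
  have hle := periodLatticeGamma1_le_neron₁_of_CDTInt hCDT D₁
  rw [Int.abs_eq_natAbs]
  by_contra hne
  have hm : 2 ≤ D₁.maninConstant.natAbs := by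
    have h1 : D₁.maninConstant.natAbs ≠ 1 := fun h ↦ hne (by rw [h]; rfl)
    have h0 : D₁.maninConstant.natAbs ≠ 0 := Int.natAbs_ne_zero.mpr hc0
    omega
  refine DivisionGamma1.not_forall_gamma1_division_of_isOptimal D₁ hopt hm fun γ ↦ ?_
  have hs : cuspSymbol D₁.f ⟨(γ : SL(2, ℤ)), Gamma1_in_Gamma0 N γ.2⟩ ∈ D₁.L.lattice :=
    hle _ (cuspSymbol_mem_periodLatticeGamma1 D₁.f γ)
  change ∃ ν ∈ D₁.L.lattice, (D₁.c : ℂ) * cuspSymbol D₁.f ⟨(γ : SL(2, ℤ)), Gamma1_in_Gamma0 N γ.2⟩ = ((D₁.c.natAbs : ℕ) : ℂ) * ν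
  rcases CDivisionUDC.intCast_eq_natAbs_or D₁.c with hc | hc
  · exact ⟨_, hs, by rw [hc]⟩
  · exact ⟨_, neg_mem hs, by rw [hc]; ring⟩

/-! ## §4 The route compositions from THEOREM 1: `|c₀| = 1` at odd `p² ∣ N`, C3, C5, `c₀ ∣ 2` at `4 ∣ N`, C2 ⟸ Thm 1 ∧ E-an-152c, `ManinConstantOne` -/

omit [W.IsElliptic] [W.IsGloballyMinimal] in
/-- **`|c₀| = 1` at every level divisible by the square of an ODD prime, modulo CDT Theorem 1** (lattice-optimal `X₀(N)`-datum of a globally minimal curve):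
`pΛ₀ ⊆ Λ₁ ⊆ Λ_W = c₀Λ₀` gives `c₀ ∣ p`, and `|c₀| = p` is the index-`p²` configuration, excluded for `p ≥ 3`
(an's `CDivisionNeron.abs_maninConstant_eq_one_of_gamma1Periods_le_of_odd_sq_dvd`).  CONDITIONAL; Manin's conjecture is not proved by this.
[cite: CalegariDimitrovTang2025, Thm. 1.0.1] [cite: LingOesterle1991, Thm. 6] [cite: AtkinLehner1970, Thm. 3] -/
theorem abs_maninConstant_eq_one_of_CDTInt_of_odd_sq_dvd [W.IsElliptic] [W.IsGloballyMinimal]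
    (hCDT : CalegariDimitrovTang2025_unboundedDenominators) (D : ModularParametrizationData W N)
    (hopt : ∀ z ∈ D.L.lattice, ∃ w ∈ periodLattice D.f, z = D.c * w) {p : ℕ} (hp : p.Prime) (h3 : 3 ≤ p) (hpN : p ^ 2 ∣ N) :
    |D.maninConstant| = 1 :=
  CDivisionNeron.abs_maninConstant_eq_one_of_gamma1Periods_le_of_odd_sq_dvd D hopt (periodLatticeGamma1_le_neron_of_CDTInt hCDT D) hp h3 hpN

/-- **C3 `ManinPrimeToThreeAtNine` (stmt-BirchSwinnertonDyer-22968) ⟸ CDT THEOREM 1** — for every lattice-optimal `X₀(N)`-datum of a globally minimal curve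
at `9 ∣ N`: `3 ∤ c₀`.  The crux's four printed-fact binders are unused.  Strictly stronger than p3's `CDivAssembly.maninPrimeToThreeAtNine_of_CDT`
(hypothesis `_algInt`).  CONDITIONAL on the printed theorem (statement-only in the tree); C3 as filed, Manin's conjecture and BSD are not proved by this.
[cite: CalegariDimitrovTang2025, Thm. 1.0.1] [cite: LingOesterle1991, Thm. 6] -/
theorem maninPrimeToThreeAtNine_of_CDTInt (hCDT : CalegariDimitrovTang2025_unboundedDenominators) :
    Summit.BirchSwinnertonDyer.BirchSwinnertonDyer.Theses.ManinLocalTwoThree.ManinPrimeToThreeAtNine := by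
  intro _hM _hAU _hC _hnf W _ _ N _ D hopt h9
  exact CDivisionNeron.not_prime_dvd_of_abs_eq_one
    (abs_maninConstant_eq_one_of_CDTInt_of_odd_sq_dvd hCDT D hopt Nat.prime_three le_rfl h9) Nat.prime_three

/-- **C5 `ManinPrimeToAdditiveFiveLe` (the declared residual, stmt-BirchSwinnertonDyer-22969) ⟸ CDT THEOREM 1** — `p ∤ c₀` for every prime `p ≥ 5` with
`p² ∣ N`.  Strictly stronger than LEAD's `CDivisionUDC.maninPrimeToAdditiveFiveLe_of_CDT`.  CONDITIONAL on the printed theorem; C5, Manin's conjecture and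
BSD are not proved by this. [cite: CalegariDimitrovTang2025, Thm. 1.0.1] [cite: LingOesterle1991, Thm. 6] -/
theorem maninPrimeToAdditiveFiveLe_of_CDTInt (hCDT : CalegariDimitrovTang2025_unboundedDenominators) :
    Summit.BirchSwinnertonDyer.BirchSwinnertonDyer.Theses.ManinLocalTwoThree.ManinPrimeToAdditiveFiveLe := by
  intro _hM _hAU _hC _hnf W _ _ N _ D hopt p hp h5 hpN
  exact CDivisionNeron.not_prime_dvd_of_abs_eq_one
    (abs_maninConstant_eq_one_of_CDTInt_of_odd_sq_dvd hCDT D hopt hp (by omega) hpN) hp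

omit [W.IsElliptic] [W.IsGloballyMinimal] in
/-- **`c₀ ∣ 2` (i.e. `c₀ ∈ {±1, ±2}`) at `4 ∣ N`, modulo CDT Theorem 1** (lattice-optimal datum); `|c₀| = 2` is exactly the index-`4` world.
[cite: CalegariDimitrovTang2025, Thm. 1.0.1] [cite: LingOesterle1991, Thm. 6] -/
theorem maninConstant_dvd_two_of_CDTInt_of_four_dvd [W.IsElliptic] [W.IsGloballyMinimal]
    (hCDT : CalegariDimitrovTang2025_unboundedDenominators) (D : ModularParametrizationData W N)
    (hopt : ∀ z ∈ D.L.lattice, ∃ w ∈ periodLattice D.f, z = D.c * w) (h4 : 2 ^ 2 ∣ N) : D.maninConstant ∣ 2 :=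
  CDivisionNeron.maninConstant_dvd_two_of_gamma1Periods_le_of_four_dvd D hopt (periodLatticeGamma1_le_neron_of_CDTInt hCDT D) h4

/-- **C2 `ManinOddAtFour` (stmt-BirchSwinnertonDyer-22967) ⟸ CDT THEOREM 1 ∧ E-an-152c `CDivisionNeron.ShimuraIndexNeFourAtFourOddSquarefree`.**  At levels with
an odd `p² ∣ N`, `|c₀| = 1` outright; on the odd-squarefree locus `2 ∣ c₀` forces the index-`4` configuration, excluded by E-an-152c.  Strictly stronger than
LEAD's `CDivisionUDC.maninOddAtFour_of_CDT_of_indexNeFourOddSquarefree`.  CONDITIONAL on the printed theorem and the OPEN row E-an-152c; C2, Manin's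
conjecture and BSD are not proved by this. [cite: CalegariDimitrovTang2025, Thm. 1.0.1] [cite: LingOesterle1991, Thm. 6] [cite: Stevens1989, §2] -/
theorem maninOddAtFour_of_CDTInt_of_indexNeFourOddSquarefree (hCDT : CalegariDimitrovTang2025_unboundedDenominators)
    (hI4 : CDivisionNeron.ShimuraIndexNeFourAtFourOddSquarefree) :
    Summit.BirchSwinnertonDyer.BirchSwinnertonDyer.Theses.ManinLocalTwoThree.ManinOddAtFour := by
  intro _hM _hAU _hC _hnf W _ _ N _ D hopt h4
  by_cases hsq : ∃ p : ℕ, p.Prime ∧ 3 ≤ p ∧ p ^ 2 ∣ N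
  · obtain ⟨p, hp, h3, hpN⟩ := hsq
    exact CDivisionNeron.not_prime_dvd_of_abs_eq_one
      (abs_maninConstant_eq_one_of_CDTInt_of_odd_sq_dvd hCDT D hopt hp h3 hpN) Nat.prime_two
  · exact CDivisionNeron.not_two_dvd_maninConstant_of_gamma1Periods_le_of_indexNeFour D hopt
      (periodLatticeGamma1_le_neron_of_CDTInt hCDT D) h4 (hI4 W D hopt h4 fun p hp h3 hpN ↦ hsq ⟨p, hp, h3, hpN⟩)

/-- **C2 ⟸ CDT THEOREM 1 ∧ E-an-152d ∧ E-an-152e** (the index-`4` residual only on the Frey-type habitat).  CONDITIONAL; C2 is not proved by this.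
[cite: CalegariDimitrovTang2025, Thm. 1.0.1] [cite: LingOesterle1991, Thm. 2 and Thm. 6] [cite: Stevens1989, §2] -/
theorem maninOddAtFour_of_CDTInt_freyHabitat (hCDT : CalegariDimitrovTang2025_unboundedDenominators)
    (hd : CDivisionNeron.IndexFourForcesFullRationalTwoTorsion) (he : CDivisionNeron.ShimuraIndexNeFourAtFourFreyHabitat) :
    Summit.BirchSwinnertonDyer.BirchSwinnertonDyer.Theses.ManinLocalTwoThree.ManinOddAtFour :=
  maninOddAtFour_of_CDTInt_of_indexNeFourOddSquarefree hCDT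
    (CDivisionNeron.shimuraIndexNeFourAtFourOddSquarefree_of_fullTwoTorsion_of_freyHabitat hd he)

/-- **THE WHOLE ROUTE FROM THEOREM 1: `ManinConstantOne` ⟸ PrintedSemistableManinFacts ∧ CDT Theorem 1 ∧ E-an-152c** — through the route's deciding theorem
`closes` and the landed `maninLocalTwoThree_assembly_proof`, with C2, C3 and the residual C5 supplied by this file.  CONDITIONAL architecture: the printed facts
(Mazur, Abbes–Ullmo, Česnavičius, modularity) and CDT Theorem 1 are `def … : Prop` hypotheses, E-an-152c is an OPEN row.  MANIN'S CONJECTURE AND BSD ARE NOT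
PROVED BY THIS. [cite: CalegariDimitrovTang2025, Thm. 1.0.1] [cite: Cesnavicius2018, Thm. 1.2] [cite: Stevens1989, §2] -/
theorem maninConstantOne_of_printedFacts_CDTInt_indexNeFourOddSquarefree
    (hPF : Summit.BirchSwinnertonDyer.BirchSwinnertonDyer.Theses.ManinLocalTwoThree.PrintedSemistableManinFacts)
    (hCDT : CalegariDimitrovTang2025_unboundedDenominators) (hI4 : CDivisionNeron.ShimuraIndexNeFourAtFourOddSquarefree) :
    Summit.BirchSwinnertonDyer.Rank1Residual.ManinConstant.ManinConstantOne :=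
  Summit.BirchSwinnertonDyer.BirchSwinnertonDyer.Theses.ManinLocalTwoThree.closes hPF
    (maninOddAtFour_of_CDTInt_of_indexNeFourOddSquarefree hCDT hI4)
    (maninPrimeToThreeAtNine_of_CDTInt hCDT)
    (maninPrimeToAdditiveFiveLe_of_CDTInt hCDT)
    maninLocalTwoThree_assembly_proof

/-! ## §5 Nothing is weakened: the algebraic-integer hypothesis implies the integer one -/

omit [W.IsElliptic] [W.IsGloballyMinimal] in
/-- The landed `_algInt` consumers are corollaries of the integer ones: `…_algInt → CalegariDimitrovTang2025_unboundedDenominators`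
(`CalegariDimitrovTang2025_unboundedDenominators_of_algInt`, Literature).  Recorded on `Λ₁(f) ⊆ Λ_W`. [cite: CalegariDimitrovTang2025, Thm. 1.0.1 and Remark 58] -/
theorem periodLatticeGamma1_le_neron_of_CDTAlgInt' [W.IsElliptic] [W.IsGloballyMinimal]
    (hCDT : CalegariDimitrovTang2025_unboundedDenominators_algInt) (D : ModularParametrizationData W N) :
    ∀ z ∈ periodLatticeGamma1 D.f, z ∈ D.L.lattice :=
  periodLatticeGamma1_le_neron_of_CDTInt (CalegariDimitrovTang2025_unboundedDenominators_of_algInt hCDT) D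

end Summit.BirchSwinnertonDyer.BirchSwinnertonDyer.Theorems.ManinLocalTwoThree.CDivisionInt

end
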